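import Summits.ValiantsHypothesis.ValiantsHypothesis.Theorems.EquivariantDialDiagonalPermify
import Summits.ValiantsHypothesis.ValiantsHypothesis.Theorems.EquivariantDialNotchTransfer
import Summits.ValiantsHypothesis.ValiantsHypothesis.Theorems.SymPencilEquivariantSdcNotQPProof
import HarnessLib

/-!
# ValiantsHypothesis — equivariant dial (decomp-valiant lens 1): the DIAGONAL NOTCH, file 2 of 2 —
# `Δ𝔖_n`-EQUIVARIANT DETERMINANTAL REPRESENTATIONS OF THE PERMANENT ARE NOT QUASI-POLYNOMIAL

Support file of the sub-window dial (cell `A = EquivariantDialNode.EqHardBiPerm`, item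
`stmt-ValiantsHypothesis-23702`; `--as helper`).  It DECIDES the cell `A_Δ = EqHard diagPermSubst` of the dial
below the window (`EquivariantDialNotchTransfer`: every `A_H`, `⊥ < H < 𝔖_m × 𝔖_m`, was UNDECIDED):

★ `diag_notQP` — there is NO constant `c` such that every `per_n` has a `Δ𝔖_n`-equivariant affine
determinantal representation (Landsberg–Ressayre: EXACT `GL × GL` lifts of the simultaneous substitutions
`x_{ij} ↦ x_{σ i, σ j}`) of size `≤ 2^{(log₂ n + c)^c}`.  Proof = crux 17792's closing composition
(`SymPencilEquivariantSdcNotQP.Closer.equivariantSdcNotQP_of_stubs`, ported as the generic `notQP_of_permify`)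
fed with the DIAGONAL permify of file 1 (`diag_permify`) instead of the window permify: permutation lifts at
quasi-polynomial cost ⇒ Dawar–Wilsenach's symmetric determinant circuits (`stub_toSymmetricCircuit`, landed)
⇒ `𝔖_n`-symmetric circuits for `per_n` of size `2^{polylog n}` ⇒ contradiction with Dawar–Wilsenach's
`2^{Ω(n)}` lower bound for square-symmetric circuits infinitely often (ToC 2025 Thm. 7.1, PROVED in the tree:
`DawarWilsenach2025_thm71_holds`).

Consequences (all by monotonicity of `EqHard` up the dial): `notQP_of_diag_le` / ★ `eqHard_of_diag_le` —
EVERY notch containing the diagonal is decided (`EqHard H` for `Δ𝔖_m ≤ H_m`); `window_notQP` and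
`equivariantSdcNotQP_of_diag` — crux 17792 `SymPencil.EquivariantSdcNotQP` re-derived WITHOUT its symmetry
hypothesis `A.IsSymm` (second proof, by restriction to the diagonal); cell A `EqHardBiPerm` is
`eqHardBiPerm_iff.2 (eqHard_of_diag_le diagPermSubst_le_biPermSubst)` (not restated: it is the landed
`EquivariantDialLocalShrinking.eqHardBiPerm`);
★ `eqHard_diag : EqHard diagPermSubst`, `eqHardLayered_diag` (no polynomial-width `Δ𝔖_m`-equivariant
homogeneous layered branching programs — the transfer `eqHard_iff_layered_of_le` of the notch file);
`symCheap_diag_iff` — at the diagonal notch the dial is at its zero-sum end: the residual piece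
`SymCheap diagPermSubst` IS `DcPerSuperpolynomial` (LESSON 6: the residual toward `W` is `W` itself).

What is new relative to print.  Dawar–Wilsenach (ToC 2025, §7.4, Cor. 7.12 and the discussion after it)
obtain the exponential lower bound for square-symmetric DETERMINANTAL REPRESENTATIONS only when the
symmetry lifts to PERMUTATION similarities of the representing matrix, and note that Landsberg–Ressayre
equivariance (arbitrary `GL × GL` lifts) "does not enforce this"; Landsberg–Ressayre's own bounds need the
torus.  Here the gap is closed over `ℂ` for the diagonal symmetric group in the not-quasi-polynomial form:
exact `GL × GL` lifts are converted into permutation conjugations at quasi-polynomial cost (conjugation normal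
form at `J`, finite central lift, Young / spin dichotomy by INFLATION `G × 𝔖_n ↠ 𝔖_n × 𝔖_n`,
Weinstein–Aronszajn extension — crux 17792's machinery, whose closed form was stated for the window
`𝔖_n × 𝔖_n` and symmetric pencils).

MODEL (non-vacuity and degenerate readings).  `Δ𝔖_n`-equivariant affine determinantal representations of
`per_n` EXIST for every `n` — Landsberg–Ressayre's `G_per`-equivariant representation of size `C(2n,n) - 1`
[cite: LandsbergRessayre2017, Thm. 2.1, construction §3] restricted to `Δ𝔖_n ≤ G_per` (kernel form:
`EquivariantDialDiagonalPermify.hasEquivariantDetRepr_diag_of_le`, with the window witnesses of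
`EquivariantDialNode.hasEquivariantDetRepr_window_of_full`), and trivially for `n ≤ 2` — so `diag_notQP` is a
lower bound on a NON-EMPTY class: a GROWTH statement, not truth-by-emptiness; its `∃ m ≤ …` is refuted by size,
not by absence of witnesses.  At `n = 0`, `per_0 = 1`; `m = 0` forces `n = 0`.

Honest framing (LESSON 6): a lower bound in a RESTRICTED (equivariant / symmetric) model — a
Landsberg–Ressayre / Dawar–Wilsenach-class statement, KNOWN-TYPE, kernel-new, obtained by TRANSFER of crux
17792; it is NOT a lower bound for `dc(per_m)`: 0 S-currency; closes NO item; NOT a route; the residual of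
every decided notch toward `DcPerSuperpolynomial` is `DcPerSuperpolynomial` itself (`symCheap_diag_iff`);
`DcPerSuperpolynomial`, Mulmuley–Sohoni, and `VP ≠ VNP` are untouched and NOT proved.  The ROW notch
`𝔖_m × 1` (cell P-ROW of the lineage) stays UNDECIDED: the Dawar–Wilsenach engine is dead there (named
columns), and the same inflation gives a ROW-permify but no lower bound.
Labels: KNOWN-TYPE (LR/DW-class restricted-model lower bound) · kernel-new · TRANSFER of 17792/17793 machinery
+ ONE new move (inflation, no index penalty) · 0 S-currency · closes NO item · NOT a route · residual of every
decided notch ≡ W (LESSON 6) · P-ROW stays UNDECIDED (DW engine dead at ROW) · DcPerSuperpolynomial / MS /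
VP ≠ VNP untouched.
-/

set_option linter.dupNamespace false

noncomputable section

namespace Summit.ValiantsHypothesis.ValiantsHypothesis.Theorems.EquivariantDialDiagonalNotQP

open MvPolynomial Matrix Literature.Computability.AlgebraicComplexity
open Summit.ValiantsHypothesis.ValiantsHypothesis.Theses
open Summit.ValiantsHypothesis.ValiantsHypothesis.Theorems.EquivariantDialNode
open Summit.ValiantsHypothesis.ValiantsHypothesis.Theorems.EquivariantDialLayers
open Summit.ValiantsHypothesis.ValiantsHypothesis.Theorems.EquivariantDialNotchTransfer
open Summit.ValiantsHypothesis.ValiantsHypothesis.Theorems.EquivariantDialDiagonalPermify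
open Summit.ValiantsHypothesis.ValiantsHypothesis.Theorems.SymPencilSdcThesisSplit
open Summit.ValiantsHypothesis.ValiantsHypothesis.Theorems.SymPencilEquivariantSdcNotQP.Closer

/-! ## §1 The closing composition, generic in the notch -/

/-- **NOT QUASI-POLYNOMIAL from a diagonal permify**, for any notch family `H`: if every `H_n`-equivariant
affine determinantal representation of `per_n` of size `m` yields one of size `2^{(log₂ m + d)^d}` whose
DIAGONAL substitutions lift to permutation conjugations, then there is no quasi-polynomial `H_n`-equivariant
family for the permanents.  Port of crux 17792's `equivariantSdcNotQP_of_stubs` (there: window, symmetric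
pencils) with `stub_toSymmetricCircuit` (landed) and Dawar–Wilsenach Thm. 7.1 (`squareSymmetricPermLB_holds`)
supplied by name; restricted-model statement, 0 S-currency. [cite: DawarWilsenach2025, Thm. 7.1] -/
theorem notQP_of_permify {H : ∀ n : ℕ, Subgroup (GL (Fin n × Fin n) ℂ)}
    (h₁ : ∃ d : ℕ, ∀ (n m : ℕ) (A : Matrix (Fin m) (Fin m) (MvPolynomial (Fin n × Fin n) ℂ)),
      IsEquivariantDetRepr (H n) (perPoly (Fin n) ℂ) A →
      ∃ m' ≤ 2 ^ ((Nat.log 2 m + d) ^ d),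
        ∃ A' : Matrix (Fin m') (Fin m') (MvPolynomial (Fin n × Fin n) ℂ),
          IsAffineDetRepr (perPoly (Fin n) ℂ) A' ∧
          ∀ σ : Equiv.Perm (Fin n), ∃ τ : Equiv.Perm (Fin m'),
            A'.map (MvPolynomial.rename fun ij : Fin n × Fin n => (σ ij.1, σ ij.2)) =
              (τ.permMatrix ℂ).map MvPolynomial.C * A' * ((τ.permMatrix ℂ)ᵀ).map MvPolynomial.C) :
    ¬ ∃ c : ℕ, ∀ n : ℕ, ∃ m ≤ 2 ^ ((Nat.log 2 n + c) ^ c),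
      HasEquivariantDetRepr (H n) (perPoly (Fin n) ℂ) m := by
  have h₂ := SymPencilEquivariantSdcNotQP.stub_toSymmetricCircuit
  have h₃ : ProofCarryingSymmetry.SquareSymmetricPermLB := squareSymmetricPermLB_holds
  rintro ⟨c, hc⟩
  obtain ⟨d, hd⟩ := h₁
  obtain ⟨e, he⟩ := h₂
  set c' : ℕ := (c + 1) * (d + 1) with hc'
  -- Step 1: symmetric circuits of size 2^{e (log₂ n + c' + 3)^{c'+1}} for every n
  have key : ∀ n : ℕ, ∃ (G : Type) (_ : Fintype G) (C : LabelledArithCircuit ℂ (Fin n × Fin n) Unit G),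
      C.IsSymmetric (Equiv.Perm (Fin n)) ∧ C.eval (C.output ()) = perPoly (Fin n) ℂ ∧
        Fintype.card G ≤ 2 ^ (e * (Nat.log 2 n + c' + 3) ^ (c' + 1)) := by
    intro n
    obtain ⟨m, hm, A, hA⟩ := hc n
    obtain ⟨m', hm', A', hA', hperm⟩ := hd n m A hA
    obtain ⟨G, hG, C, hCs, hCe, hcard⟩ := he n m' A' hA' hperm
    refine ⟨G, hG, C, hCs, hCe, hcard.trans ?_⟩
    have hm'' : m' ≤ 2 ^ ((Nat.log 2 n + c') ^ c') := hm'.trans (qpBound_comp_qpBound hm)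
    calc (m' + 2) ^ e ≤ (2 ^ ((Nat.log 2 n + c') ^ c') + 2) ^ e := Nat.pow_le_pow_left (by omega) e
      _ ≤ 2 ^ (e * (Nat.log 2 n + c' + 3) ^ (c' + 1)) := size_exp_bound _ c' e
  choose G hG C hCs hCe hcard using key
  obtain ⟨ε, hε, hio⟩ := @h₃ G hG C hCs hCe
  -- Step 2: the exponent is polylog, eventually below ε n
  have hδ : (0 : ℝ) < ε / (e + 1) := by positivity
  obtain ⟨N, hN⟩ := polylog_eventually_lt (c' + 1) (c' + 3) hδ
  obtain ⟨n, hn, hbig⟩ := hio N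
  have h1 := hN n hn
  have hnpos : (0 : ℝ) < n := by
    by_contra h0
    rw [not_lt] at h0
    have hz : (n : ℝ) = 0 := le_antisymm h0 (Nat.cast_nonneg n)
    rw [hz, mul_zero] at h1
    exact absurd h1 (not_lt.2 (by positivity))
  have he0 : (0 : ℝ) ≤ e := Nat.cast_nonneg e
  have h1' : (e : ℝ) * (((Nat.log 2 n + c' + 3 : ℕ) : ℝ)) ^ (c' + 1) ≤ (e : ℝ) * (ε / (e + 1) * n) := by
    have heq : (((Nat.log 2 n + c' + 3 : ℕ) : ℝ)) = (Nat.log 2 n : ℝ) + ((c' + 3 : ℕ) : ℝ) := by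
      push_cast; ring
    rw [heq]
    exact mul_le_mul_of_nonneg_left h1.le he0
  have hexpR : ((e * (Nat.log 2 n + c' + 3) ^ (c' + 1) : ℕ) : ℝ) < ε * n := by
    rw [Nat.cast_mul, Nat.cast_pow]
    calc (e : ℝ) * (((Nat.log 2 n + c' + 3 : ℕ) : ℝ)) ^ (c' + 1) ≤ (e : ℝ) * (ε / (e + 1) * n) := h1'
      _ = (e / (e + 1)) * (ε * n) := by ring
      _ < 1 * (ε * n) := by
          apply mul_lt_mul_of_pos_right _ (by positivity)
          rw [div_lt_one (by positivity)]
          linarith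
      _ = ε * n := one_mul _
  -- Step 3: 2^{ε n} ≤ |C_n| ≤ 2^{exponent} forces ε n ≤ exponent, contradiction
  have hsizeR : (Fintype.card (G n) : ℝ) ≤
      (2 : ℝ) ^ (((e * (Nat.log 2 n + c' + 3) ^ (c' + 1) : ℕ)) : ℝ) := by
    rw [Real.rpow_natCast]
    exact_mod_cast hcard n
  have hchain := (Real.rpow_le_rpow_left_iff one_lt_two).1 (hbig.trans hsizeR)
  linarith

/-! ## §2 The diagonal notch is not quasi-polynomial -/

/-- ★ **THE DIAGONAL NOTCH DECIDED (restricted-model lower bound).**  There is no quasi-polynomial family of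
`Δ𝔖_n`-equivariant (exact `GL × GL` lifts of `x_{ij} ↦ x_{σ i, σ j}`) affine determinantal representations of
the permanents over `ℂ`: `notQP_of_permify diag_permify`.  A Dawar–Wilsenach-class statement for
Landsberg–Ressayre equivariance at the diagonal; 0 S-currency; closes NO item; `VP ≠ VNP` untouched.
[cite: DawarWilsenach2025, Thm. 7.1] [cite: LandsbergRessayre2017, Def. 1.3] -/
theorem diag_notQP : ¬ ∃ c : ℕ, ∀ n : ℕ, ∃ m ≤ 2 ^ ((Nat.log 2 n + c) ^ c),
    HasEquivariantDetRepr (diagPermSubst n) (perPoly (Fin n) ℂ) m :=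
  notQP_of_permify diag_permify

/-- Every notch CONTAINING the diagonal is not quasi-polynomial (anti-monotonicity of equivariance). -/
theorem notQP_of_diag_le {H : ∀ n : ℕ, Subgroup (GL (Fin n × Fin n) ℂ)}
    (hle : ∀ n, diagPermSubst n ≤ H n) :
    ¬ ∃ c : ℕ, ∀ n : ℕ, ∃ m ≤ 2 ^ ((Nat.log 2 n + c) ^ c),
      HasEquivariantDetRepr (H n) (perPoly (Fin n) ℂ) m := by
  rintro ⟨c, hc⟩
  refine diag_notQP ⟨c, fun n => ?_⟩
  obtain ⟨m, hm, hA⟩ := hc n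
  exact ⟨m, hm, hA.anti (hle n)⟩

/-- The WINDOW `𝔖_n × 𝔖_n` is not quasi-polynomial (the conclusion of crux 17792 without `A.IsSymm`). -/
theorem window_notQP : ¬ ∃ c : ℕ, ∀ n : ℕ, ∃ m ≤ 2 ^ ((Nat.log 2 n + c) ^ c),
    HasEquivariantDetRepr (biPermSubst n) (perPoly (Fin n) ℂ) m :=
  notQP_of_diag_le diagPermSubst_le_biPermSubst

/-- Crux 17792 `SymPencil.EquivariantSdcNotQP` RE-DERIVED from the diagonal notch (second proof; the symmetry
hypothesis `A.IsSymm` of the crux is simply dropped). [folklore] -/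
theorem equivariantSdcNotQP_of_diag : SymPencil.EquivariantSdcNotQP := by
  rintro ⟨c, hc⟩
  refine window_notQP ⟨c, fun n => ?_⟩
  obtain ⟨m, hm, A, -, hA⟩ := hc n
  exact ⟨m, hm, A, hA⟩

/-! ## §3 Dial corollaries: the cells at and above the diagonal -/

/-- ★ **CELL `A_Δ` PROVED: `EqHard diagPermSubst`** — no polynomial-size family of `Δ𝔖_m`-equivariant affine
determinantal representations of the permanents (polynomial ⊂ quasi-polynomial, `IsPBounded.isQPBounded`).
Restricted-model lower bound; 0 S-currency; closes NO item. [folklore] -/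
theorem eqHard_diag : EqHard diagPermSubst := by
  rintro ⟨c, hc⟩
  choose s hs hA using hc
  obtain ⟨c', hc'⟩ := IsPBounded.isQPBounded (t := s) ⟨c, hs⟩
  exact diag_notQP ⟨c', fun n => ⟨s n, hc' n, hA n⟩⟩

/-- ★ **Every notch containing the diagonal is decided**: `EqHard H` whenever `Δ𝔖_m ≤ H_m` for all `m`
(monotonicity of `EqHard` up the dial). [folklore] -/
theorem eqHard_of_diag_le {H : ∀ m : ℕ, Subgroup (GL (Fin m × Fin m) ℂ)}
    (hle : ∀ m, diagPermSubst m ≤ H m) : EqHard H :=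
  eqHard_diag.mono hle

/-- The LAYERED cell at the diagonal: no polynomial-width family of `Δ𝔖_m`-equivariant homogeneous layered
branching programs for the permanents (notch transfer `eqHard_iff_layered_of_le`). [folklore] -/
theorem eqHardLayered_diag : EqHardLayered diagPermSubst :=
  (eqHard_iff_layered_of_le diagPermSubst_le_biPermSubst).1 eqHard_diag

/-- TERMINAL STATE of the diagonal notch (LESSON 6): its residual piece `SymCheap Δ` toward `W` IS `W`. -/
theorem symCheap_diag_iff : SymCheap diagPermSubst ↔ DcPerSuperpolynomial ℂ :=
  symCheap_iff_W_of_eqHard eqHard_diag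

/-- … and so is the residual of every notch containing the diagonal. [folklore] -/
theorem symCheap_iff_W_of_diag_le {H : ∀ m : ℕ, Subgroup (GL (Fin m × Fin m) ℂ)}
    (hle : ∀ m, diagPermSubst m ≤ H m) : SymCheap H ↔ DcPerSuperpolynomial ℂ :=
  symCheap_iff_W_of_eqHard (eqHard_of_diag_le hle)

end Summit.ValiantsHypothesis.ValiantsHypothesis.Theorems.EquivariantDialDiagonalNotQP

end
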